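import Summits.QuantumFields.YangMills.Theorems.BalabanUVNodesN07CentralResponseNormalForm
import Literature.MathematicalPhysics.QuantumFieldTheory.Balaban1983to89.EMLFibreMapInjective
import Literature.MathematicalPhysics.QuantumFieldTheory.Balaban1983to89.Node00.DatumAvLayer
import Summits.QuantumFields.YangMills.Theorems.BalabanUVNodesN09LiftInvariance29AtRecord

/-!
# NODE N09 [B12] — THE ONE-VARIABLE (0.4) AVERAGE IN ITS PRIVATE COORDINATE IS INJECTIVE ON THE SMALL WINDOW, AT THE CELL'S TYPES AND AT THE RECORD:
# the reading of `EMLFibreMapInjective` through n07-w2's normal form `coe_avgFun_update_centralBond_SUN`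

Cell `pub-ymgap` (YM-PLAN Track A), width seat `pub-ymgap-dag-n09-w6` g3; helper of the K1 item of record (`--supports`, `--as helper`, count-neutral).
[I] = [Balaban1987RG1].  CONSUMED BY NAME: `…N07CentralResponseNormalForm.coe_avgFun_update_centralBond_SUN` (n07-w2 g2: under the (0.4) guard,
`↑Ū′(c) = eml(i ↦ central ? 1 : ↑V_i·(↑pre·↑g·↑post)*)·(↑pre·↑g·↑post)` for `U′ = U[β(c) ↦ g]`), `EMLFibreMapInjective.eml_fibreMap_eq_imp_eq` (this seat: the
generic injectivity of `W ↦ eml(F_W)·W` on `{‖W‖ ≤ 1, ‖h_i W* − 1‖ ≤ α}` for `α ≤ 1∕24`, `m∕|I| + 150α < 1`), `BlockAveragingEMLHaarAC.offCard`, `Node00.avOfRecord_avg` (`rfl`).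

WHAT IS PROVED (0 def, 0 sorry).  ★★★ `avgFun_update_centralBond_injOn` — for `j + 1 ≤ m + K`, every `U`, every coarse bond `c`, `0 ≤ α ≤ 1∕24` with
`offCard c ∕ |Idx P| + 150·α < 1`: the map `g ↦ Ū′(c)` (`ℰ = expMeanLogSU`) is INJECTIVE on the WINDOW
`{g | (0.4) guard at U′ ∧ ∀ off-central i, ‖↑V_i·(↑pre·↑g·↑post)* − 1‖ ≤ α}`; `avOfRecord_update_centralBond_injOn` — the same for the averaging of record
`avOfRecord F N K j` at every `j < K`.  This is the INJECTIVITY half of the per-bond data the private-coordinate road to `hreg` displays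
(`…N09PerBondChartsOfInjectivityWindows`); the window is BLIND to the private coordinates (the `V_i`, `pre`, `post` do not see them — FACT (A) of
`BlockAveragingHaarAC`), a fact the successor records with the forward Jacobian law.

HONEST FRAMING.  Count-neutral kernel bookkeeping; no Jacobian law, no support clause, no continuity; nothing of Bałaban's asserted (the (0.4) operation and its
guard are the tree's typed objects); `hreg` NOT discharged; N09 NOT discharged; conjunct 1 (Lemma 4) and FLAG №7 untouched; K0∕K1 NOT closed; counts unmoved
(typed 28∕28 · discharged 5∕27); one finite four-torus programme at fixed `ε` — R4 closes the conditional rung `BalabanLadder.UV` only; NOT ℝ⁴ ∕ OS ∕ mass gap ∕ Clay.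
-/

noncomputable section

open scoped Matrix.Norms.L2Operator

namespace Summit.QuantumFields.YangMills.BalabanUVNodes.N09CentralWindowInjective

open Set Function
open Literature.MathematicalPhysics.QuantumFieldTheory.Balaban1983to89
open Literature.MathematicalPhysics.QuantumFieldTheory.Balaban1983to89.T4Continuum (T4Family)
open Literature.MathematicalPhysics.QuantumFieldTheory.Balaban1983to89.BlockAveraging (Small Idx avgFun)
open Literature.MathematicalPhysics.QuantumFieldTheory.Balaban1983to89.BlockAveragingHaarAC (centralBond pre post openHol IsCentral)
open Literature.MathematicalPhysics.QuantumFieldTheory.Balaban1983to89.BlockAveragingEMLHaarAC (offCard)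
open Literature.MathematicalPhysics.QuantumFieldTheory.Balaban1983to89.ExpMeanLog (eml expMeanLogSU)
open Literature.MathematicalPhysics.QuantumFieldTheory.Balaban1983to89.EMLFibreMapInjective (eml_fibreMap_eq_imp_eq)
open Literature.MathematicalPhysics.QuantumFieldTheory.Balaban1983to89.Node00
open Summit.QuantumFields.YangMills.BalabanUVNodes.N07CentralResponseNormalForm (coe_avgFun_update_centralBond_SUN)
open Summit.QuantumFields.YangMills.BalabanUVNodes.N09LiftInvariance29AtRecord (succ_le_range_of_lt)

variable {P : Params} {j : ℕ} {N : ℕ} [NeZero N]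

/-- An `SU(N)` matrix has `L²`-operator norm at most `1`. [cite: Balaban1987RG1, (0.4) p.253 (bookkeeping)] -/
theorem norm_coe_SU_le_one (g : SU N) : ‖(g : Matrix (Fin N) (Fin N) ℂ)‖ ≤ 1 := by
  haveI : Nonempty (Fin N) := ⟨⟨0, Nat.pos_of_ne_zero (NeZero.ne N)⟩⟩
  exact (CStarRing.norm_of_mem_unitary (Matrix.specialUnitaryGroup_le_unitaryGroup g.2)).le

/-- `offCard c` is the number of off-central indices, as a filtered cardinality. [cite: Balaban1987RG1, (0.4) p.253 (bookkeeping)] -/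
theorem offCard_eq_card_filter (c : PBond P (j + 1)) : offCard c = (Finset.univ.filter fun i : Idx P => ¬ IsCentral c i).card :=
  Fintype.card_subtype _

/-- Cancelling the fixed outer factors: `pre·g₁·post = pre·g₂·post ⇒ g₁ = g₂` in `SU(N)`. [cite: Balaban1987RG1, (0.4) p.253 (bookkeeping)] -/
theorem eq_of_pre_mul_mul_post_eq (U : GaugeField P j (SU N)) (c : PBond P (j + 1)) {g₁ g₂ : SU N}
    (h : ((pre U c : SU N) : Matrix (Fin N) (Fin N) ℂ) * (g₁ : Matrix (Fin N) (Fin N) ℂ) * ((post U c : SU N) : Matrix (Fin N) (Fin N) ℂ) =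
      ((pre U c : SU N) : Matrix (Fin N) (Fin N) ℂ) * (g₂ : Matrix (Fin N) (Fin N) ℂ) * ((post U c : SU N) : Matrix (Fin N) (Fin N) ℂ)) :
    g₁ = g₂ := by
  have h2 := congrArg (fun M => star ((pre U c : SU N) : Matrix (Fin N) (Fin N) ℂ) * M * star ((post U c : SU N) : Matrix (Fin N) (Fin N) ℂ)) h
  simp only [mul_assoc, coe_mul_star_coe_SU, mul_one, star_coe_mul_coe_mul_SU] at h2
  exact Subtype.ext h2

/-- ★★★ **THE ONE-VARIABLE (0.4) AVERAGE IN ITS PRIVATE COORDINATE IS INJECTIVE ON THE SMALL WINDOW.**  For `j + 1 ≤ m + K`, a configuration `U`, a coarse bond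
`c`, and `0 ≤ α ≤ 1∕24` with `offCard c ∕ |Idx P| + 150·α < 1`: the map `g ↦ Ū′(c)`, `U′ = U[β(c) ↦ g]`, of the block averaging (0.4) with the printed inner
operation is INJECTIVE on `{g | Small ℰ U′ c ∧ ∀ i off-central, ‖↑V_i·(↑pre·↑g·↑post)* − 1‖ ≤ α}` (`V_i = openHol U c i`).
[cite: Balaban1987RG1, (0.4) p.253 and p.267] -/
theorem avgFun_update_centralBond_injOn (hj : j + 1 ≤ P.m + P.K) (U : GaugeField P j (SU N)) (c : PBond P (j + 1)) {α : ℝ}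
    (hα0 : 0 ≤ α) (hα : α ≤ 1 / 24) (hgap : (offCard c : ℝ) / (Fintype.card (Idx P) : ℝ) + 150 * α < 1) :
    InjOn (fun g : SU N => avgFun (expMeanLogSU (n := Fin N)) (Function.update U (centralBond c) g) c)
      {g : SU N | Small (expMeanLogSU (n := Fin N)) (Function.update U (centralBond c) g) c ∧
        ∀ i : Idx P, ¬ IsCentral c i →
          ‖((openHol U c i : SU N) : Matrix (Fin N) (Fin N) ℂ) *
              star (((pre U c : SU N) : Matrix (Fin N) (Fin N) ℂ) * (g : Matrix (Fin N) (Fin N) ℂ) * ((post U c : SU N) : Matrix (Fin N) (Fin N) ℂ)) - 1‖ ≤ α} := by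
  intro g₁ hg₁ g₂ hg₂ heq
  have hK := congrArg (fun x : SU N => (x : Matrix (Fin N) (Fin N) ℂ)) heq
  simp only at hK
  rw [coe_avgFun_update_centralBond_SUN hj U c g₁ hg₁.1, coe_avgFun_update_centralBond_SUN hj U c g₂ hg₂.1] at hK
  have hgap' : ((Finset.univ.filter fun i : Idx P => ¬ IsCentral c i).card : ℝ) / (Fintype.card (Idx P) : ℝ) + 150 * α < 1 := by
    rw [← offCard_eq_card_filter]; exact hgap
  have hW : ∀ g : SU N, ‖((pre U c : SU N) : Matrix (Fin N) (Fin N) ℂ) * (g : Matrix (Fin N) (Fin N) ℂ) * ((post U c : SU N) : Matrix (Fin N) (Fin N) ℂ)‖ ≤ 1 :=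
    fun g => by
      have : ((pre U c : SU N) : Matrix (Fin N) (Fin N) ℂ) * (g : Matrix (Fin N) (Fin N) ℂ) * ((post U c : SU N) : Matrix (Fin N) (Fin N) ℂ) =
          ((pre U c * g * post U c : SU N) : Matrix (Fin N) (Fin N) ℂ) := by simp only [Submonoid.coe_mul]
      rw [this]; exact norm_coe_SU_le_one _
  have hmat := eml_fibreMap_eq_imp_eq (IsCentral c) (fun i => ((openHol U c i : SU N) : Matrix (Fin N) (Fin N) ℂ))
    (fun i _ => norm_coe_SU_le_one _) hα0 hα hgap' (hW g₁) hg₁.2 (hW g₂) hg₂.2 hK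
  exact eq_of_pre_mul_mul_post_eq U c hmat

variable {F : T4Family}

/-- ★★★ **AT THE RECORD**: for every torus `F.P K` of the family and every level `j < K`, the one-variable map of the averaging of record
`g ↦ (avOfRecord F N K j).avg (U[β(c) ↦ g]) c` is injective on the small window (same hypotheses). [cite: Balaban1987RG1, (0.4) p.253 and p.267] -/
theorem avOfRecord_update_centralBond_injOn {K : ℕ} (hj : j < K) (U : GaugeField (F.P K) j (SU N)) (c : PBond (F.P K) (j + 1)) {α : ℝ}
    (hα0 : 0 ≤ α) (hα : α ≤ 1 / 24) (hgap : (offCard c : ℝ) / (Fintype.card (Idx (F.P K)) : ℝ) + 150 * α < 1) :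
    InjOn (fun g : SU N => (avOfRecord F N K j).avg (Function.update U (centralBond c) g) c)
      {g : SU N | Small (expMeanLogSU (n := Fin N)) (Function.update U (centralBond c) g) c ∧
        ∀ i : Idx (F.P K), ¬ IsCentral c i →
          ‖((openHol U c i : SU N) : Matrix (Fin N) (Fin N) ℂ) *
              star (((pre U c : SU N) : Matrix (Fin N) (Fin N) ℂ) * (g : Matrix (Fin N) (Fin N) ℂ) * ((post U c : SU N) : Matrix (Fin N) (Fin N) ℂ)) - 1‖ ≤ α} :=
  avgFun_update_centralBond_injOn (succ_le_range_of_lt hj) U c hα0 hα hgap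

end Summit.QuantumFields.YangMills.BalabanUVNodes.N09CentralWindowInjective

end
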